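import Summits.CriticalPhenomena.PercolationContinuityZ3.Theorems.Transplant.KNLevelsStepIV
import Literature.Probability.Percolation.SitePaths
import Literature.Probability.Percolation.SharpnessDCTProofs
import Literature.Probability.Percolation.BlockExplorationBasic
import Literature.Probability.LatticeModels.ProdBernoulliClusterLocality
import HarnessLib

/-!
# ENTRANCES: an open path from outside a region `D` to a point of `D` enters `D` through an open edge `a ∼ b`, `a ∉ D`, `b ∈ D`, and then
# stays in `D` — so `P(root ↔ T) ≤ P(linkIn D A T)` for any set `A` of vertices of `D` containing every possible entrance
# (the reduction of the EXCESS hypothesis of the corridor chains to p3's collar event `BoxProdZ2.excess`; design (D), §11 v2)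

builds on p205010 (kernel theorem, internal audit signed; external expert review pending) — nothing in this file uses p205010.
Lane `prim-bschramm`, seat `prim-bschramm-p3` (order I2 of V56); helper file (`--supports stmt-CriticalPhenomena-4575 --as helper`).

* `exists_entrance_of_openConn` — deterministic: if every open pair is an edge of `G`, `root ∉ D`, `t ∈ D` and `ω ∈ {root ↔ t}`, then there
  are `a ∉ D`, `b ∈ D` with `G.Adj a b`, `s(a,b) ∈ ω` and `ω ∈ {b ↔ t inside D}` (the LAST entrance: `PathIn.last_exit` from the complement);
* **`real_biUnion_openConn_le_linkIn`** — for a weighting `W` vanishing off the edges of `G`: if every `b ∈ D` joined to some `a ∉ D` by an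
  edge of positive weight lies in `A`, then `P_W(⋃_{t ∈ T} {root ↔ t}) ≤ P_W(linkIn D A T)` (`T ⊆ D`, `root ∉ D`).
[cite: DuminilCopinTassionCMP2016, Thm. 1.1 (proof, item 1: the last vertex of the path in the set)] [cite: KozmaNitzan2024, §4 Lemma 12 (p. 24)]
-/

noncomputable section

open MeasureTheory

namespace Summit.CriticalPhenomena.PercolationContinuityZ3.Theorems

namespace Transplant

namespace KNLevels

open Literature.Probability.Percolation Literature.Probability.LatticeModels SimpleGraph

variable {V : Type*} [DecidableEq V] {G : SimpleGraph V}

omit [DecidableEq V] in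
/-- An open path all of whose edges end in `A` is a path inside `A` (from a start in `A`). [folklore] -/
theorem pathIn_of_forall_adj_mem {ω : BondConfig V} {A : Set V} (hA : ∀ a b, (openGraph ω).Adj a b → b ∈ A) {u v : V} (hu : u ∈ A)
    (h : PathIn (openGraph ω) Set.univ u v) : PathIn (openGraph ω) A u v := by
  obtain ⟨-, h⟩ := h
  refine ⟨hu, ?_⟩
  induction h with
  | refl => exact Relation.ReflTransGen.refl
  | tail _ hbc ih => exact ih.tail ⟨hbc.1, hA _ _ hbc.1⟩

omit [DecidableEq V] in
/-- **The last entrance.**  If every open pair of `ω` is an edge of `G`, `root ∉ D`, `t ∈ D` and `root ↔ t`, then the open path enters `D`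
a last time through an open edge `a ∼ b` of `G` (`a ∉ D`, `b ∈ D`) and then stays inside `D`.
[cite: DuminilCopinTassionCMP2016, Thm. 1.1 (proof, item 1)] -/
theorem exists_entrance_of_openConn {D : Set V} {root t : V} (hroot : root ∉ D) (ht : t ∈ D) {ω : BondConfig V}
    (hωG : ∀ e ∈ ω, e ∈ G.edgeSet) (h : ω ∈ openConn root t) :
    ∃ a b, a ∉ D ∧ b ∈ D ∧ G.Adj a b ∧ s(a, b) ∈ ω ∧ ω ∈ openConnIn D b t := by
  rw [BlockExploration.mem_openConn_iff_openConnIn_univ] at h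
  have hp := DCT16.mem_openConnIn_iff_pathIn.1 h
  obtain ⟨a, b, ha, -, hb, hab, hpb⟩ := hp.last_exit (C := Dᶜ) hroot (fun h' => h' ht)
  have hb' : b ∈ D := Set.notMem_compl_iff.1 hb
  have he : s(a, b) ∈ ω := ((openGraph_adj ω a b).1 hab).1
  refine ⟨a, b, ha, hb', ?_, he, ?_⟩
  · exact (SimpleGraph.mem_edgeSet G).1 (hωG _ he)
  · rw [DCT16.mem_openConnIn_iff_pathIn]
    exact hpb.mono fun x hx => Set.notMem_compl_iff.1 hx.2

omit [DecidableEq V] in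
/-- Monotonicity of a finite measure under an almost-sure inclusion (real-valued). [folklore] -/
private theorem measureReal_mono_ae {α : Type*} [MeasurableSpace α] {μ : Measure α} [IsFiniteMeasure μ] {s t : Set α}
    (h : ∀ᵐ x ∂μ, x ∈ s → x ∈ t) : μ.real s ≤ μ.real t := by
  simp only [measureReal_def]
  exact ENNReal.toReal_mono (measure_ne_top μ t) (measure_mono_ae h)

omit [DecidableEq V] in
/-- **From `root ↔ T` to the entrance-link event.**  Let `W` vanish off the edges of `G`, `root ∉ D ⊇ T`, and let `A ⊆ D` contain every vertex
`b ∈ D` joined to a vertex `a ∉ D` by an edge of `G` of positive weight.  Then `P_W(⋃_{t ∈ T} {root ↔ t}) ≤ P_W(linkIn D A T)`.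
[cite: KozmaNitzan2024, §4 Lemma 12 (p. 24)] -/
theorem real_biUnion_openConn_le_linkIn [Countable V] {W : Sym2 V → unitInterval} (hWG : ∀ e, e ∉ G.edgeSet → W e = 0)
    {D T A : Finset V} (hT : T ⊆ D) {root : V} (hroot : root ∉ D)
    (hA : ∀ a b, a ∉ D → b ∈ D → G.Adj a b → W s(a, b) ≠ 0 → b ∈ A) :
    (prodBernoulli W).real (⋃ t ∈ T, openConn root t) ≤ (prodBernoulli W).real (linkIn (↑D : Set V) A T) := by
  have hae : ∀ᵐ ω ∂prodBernoulli W, ∀ e ∈ {e : Sym2 V | W e = 0}, e ∉ ω :=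
    prodBernoulli_ae_forall_notMem W (Set.to_countable _) fun e he => he
  refine measureReal_mono_ae ?_
  filter_upwards [hae] with ω hω hmem
  simp only [Set.mem_iUnion, exists_prop] at hmem
  obtain ⟨t, htT, hωt⟩ := hmem
  have hωG : ∀ e ∈ ω, e ∈ G.edgeSet := fun e he => by
    by_contra h'
    exact hω e (hWG e h') he
  obtain ⟨a, b, ha, hb, hab, he, hbt⟩ :=
    exists_entrance_of_openConn (D := (↑D : Set V)) (fun h => hroot (Finset.mem_coe.1 h)) (Finset.mem_coe.2 (hT htT)) hωG hωt
  have hWe : W s(a, b) ≠ 0 := fun h0 => hω _ h0 he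
  exact (mem_linkIn_iff).2 ⟨b, hA a b (fun h => ha (Finset.mem_coe.2 h)) (Finset.mem_coe.1 hb) hab hWe, t, htT, hbt⟩

/-! ## §2 Wiring the source of a link event

For the ELONGATED kit routes of the face step (KN Lemma 11 in the product): the link event `linkIn U S T` (`S ∩ T = ∅`) does not depend on
the pairs INSIDE `S` — after its last visit to `S` a witnessing open path uses no such pair — so its probability is unchanged when `S` is
wired (no hypothesis `S ⊆ U` is needed for that), and under the wired law it is implied by a point-source connection from any `o ∈ S`; this turns the route bound into a straight-run
chain from a wired point source (p2-g2's `hQ0_of_chain_sub` pattern). -/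

omit [DecidableEq V] in
/-- Paths inside a set `A` transfer between configurations agreeing on the pairs with both endpoints in `A`. [folklore] -/
theorem pathIn_congr_openGraph {ω ω' : BondConfig V} {K : Set (Sym2 V)} (h : ω ∩ K = ω' ∩ K) {A : Set V}
    (hA : ∀ c d, c ∈ A → d ∈ A → s(c, d) ∈ K) {u v : V} (hp : PathIn (openGraph ω) A u v) : PathIn (openGraph ω') A u v := by
  obtain ⟨hu, hp⟩ := hp
  refine ⟨hu, ?_⟩
  induction hp with
  | refl => exact Relation.ReflTransGen.refl
  | @tail c d hc hcd ih =>
    have hcA : c ∈ A := PathIn.right_mem (show PathIn (openGraph ω) A u c from ⟨hu, hc⟩)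
    exact ih.tail ⟨(DCT16.openGraph_adj_congr h (hA c d hcA hcd.2)).1 hcd.1, hcd.2⟩

omit [DecidableEq V] in
/-- One direction of `determinedBy_linkIn_compl_wireSet`. [folklore] -/
theorem linkIn_of_agree_compl_wireSet {U : Set V} {S T : Finset V} (hST : Disjoint S T)
    {ω ω' : BondConfig V} (h : ω ∩ (wireSet (↑S : Set V))ᶜ = ω' ∩ (wireSet (↑S : Set V))ᶜ) (hω : ω ∈ linkIn U S T) :
    ω' ∈ linkIn U S T := by
  obtain ⟨s, hs, t, ht, hst⟩ := mem_linkIn_iff.1 hω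
  have htS : t ∉ (↑S : Set V) := fun h' => Finset.disjoint_left.1 hST (Finset.mem_coe.1 h') ht
  have hp := DCT16.mem_openConnIn_iff_pathIn.1 hst
  obtain ⟨a, b, ha, haU, hb, hab, hpb⟩ := hp.last_exit (C := (↑S : Set V)) (Finset.mem_coe.2 hs) htS
  have hK : ∀ c d : V, d ∉ (↑S : Set V) → s(c, d) ∈ (wireSet (↑S : Set V))ᶜ := fun c d hd hcd =>
    hd (mk_mem_wireSet_iff.1 hcd).2.1
  have hab' : (openGraph ω').Adj a b := (DCT16.openGraph_adj_congr h (hK a b hb)).1 hab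
  have hpb' : PathIn (openGraph ω') (U \ ↑S) b t := pathIn_congr_openGraph h (fun c d _ hd => hK c d hd.2) hpb
  refine mem_linkIn_iff.2 ⟨a, Finset.mem_coe.1 ha, t, ht, DCT16.mem_openConnIn_iff_pathIn.2 ?_⟩
  exact (PathIn.of_adj haU hpb'.left_mem.1 hab').trans (hpb'.mono fun x hx => hx.1)

omit [DecidableEq V] in
/-- **The link event from `S` does not depend on the pairs inside `S`** (`S ⊆ U`, `S ∩ T = ∅`). [folklore] -/
theorem determinedBy_linkIn_compl_wireSet (U : Set V) {S T : Finset V} (hST : Disjoint S T) :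
    DeterminedBy (linkIn U S T) (wireSet (↑S : Set V))ᶜ := by
  rw [determinedBy_iff]
  intro ω ω' h
  exact ⟨linkIn_of_agree_compl_wireSet hST h, linkIn_of_agree_compl_wireSet hST h.symm⟩

omit [DecidableEq V] in
/-- **Wiring the source leaves the link probability unchanged**: two weightings agreeing off the pairs inside `S` give `linkIn U S T` the same
probability. [folklore] -/
theorem real_linkIn_eq_of_agree_off_source [Countable V] {W W' : Sym2 V → unitInterval} (U : Finset V) {S T : Finset V}
    (hST : Disjoint S T) (h : ∀ e, e ∉ wireSet (↑S : Set V) → W e = W' e) :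
    (prodBernoulli W).real (linkIn (↑U : Set V) S T) = (prodBernoulli W').real (linkIn (↑U : Set V) S T) :=
  prodBernoulli_real_eq_of_determinedBy W W' (F := (wireSet (↑S : Set V))ᶜ) (fun e he => h e he)
    (determinedBy_linkIn_compl_wireSet (↑U) hST) (measurableSet_linkIn U S T)

omit [DecidableEq V] in
/-- In particular for the law PINNED on a set of pairs inside `S` (e.g. `S` wired open: `F₀ = pat = edgesIn G S`). [folklore] -/
theorem real_linkIn_eq_pinW_source [Countable V] (W : Sym2 V → unitInterval) (U : Finset V) {S T : Finset V} (hST : Disjoint S T)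
    {F₀ : Set (Sym2 V)} (hF₀ : F₀ ⊆ wireSet (↑S : Set V)) (pat : Set (Sym2 V)) :
    (prodBernoulli W).real (linkIn (↑U : Set V) S T) = (prodBernoulli (pinW W F₀ pat)).real (linkIn (↑U : Set V) S T) :=
  real_linkIn_eq_of_agree_off_source U hST fun _ he => (pinW_apply_of_not_mem W pat fun h' => he (hF₀ h')).symm

omit [DecidableEq V] in
/-- A `G`-path inside `A` all of whose `G`-edges inside `A` are open is an open path inside any `U ⊇ A`. [folklore] -/
theorem pathIn_openGraph_of_open {A U : Set V} (hAU : A ⊆ U) {ω : BondConfig V}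
    (hopen : ∀ c d, c ∈ A → d ∈ A → G.Adj c d → s(c, d) ∈ ω) {u v : V} (hp : PathIn G A u v) : PathIn (openGraph ω) U u v := by
  obtain ⟨hu, hp⟩ := hp
  refine ⟨hAU hu, ?_⟩
  induction hp with
  | refl => exact Relation.ReflTransGen.refl
  | @tail c d hc hcd ih =>
    have hcA : c ∈ A := PathIn.right_mem (show PathIn G A u c from ⟨hu, hc⟩)
    refine ih.tail ⟨?_, hAU hcd.2⟩
    rw [openGraph_adj]
    exact ⟨hopen c d hcA hcd.2 hcd.1, hcd.1.ne⟩

omit [DecidableEq V] in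
/-- **A wired, internally connected source**: if every `s ∈ S` is joined to `o` by a `G`-path inside `S` and all edges of `G` inside `S` are
open, then the link event from `S` implies the point-source connection from `o` (inside `U ⊇ S`). [folklore] -/
theorem linkIn_subset_biUnion_openConnIn_of_wired {U : Set V} {S T : Finset V} (hSU : (↑S : Set V) ⊆ U) {o : V}
    (hconn : ∀ s ∈ S, PathIn G (↑S : Set V) o s) {ω : BondConfig V}
    (hopen : ∀ c d, c ∈ (↑S : Set V) → d ∈ (↑S : Set V) → G.Adj c d → s(c, d) ∈ ω) (hω : ω ∈ linkIn U S T) :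
    ω ∈ ⋃ t ∈ T, openConnIn U o t := by
  obtain ⟨s, hs, t, ht, hst⟩ := mem_linkIn_iff.1 hω
  simp only [Set.mem_iUnion, exists_prop]
  refine ⟨t, ht, ?_⟩
  rw [DCT16.mem_openConnIn_iff_pathIn] at hst ⊢
  exact (pathIn_openGraph_of_open hSU hopen (hconn s hs)).trans hst

/-! ## §3 Subboxes survive pinning a disjoint source

The inner straight-run chain of an elongated route runs under the law with the source `S` wired (`pinW W (wireSet S) pat`); its step
regions are disjoint from `S`, so they stay subboxes (`IsSubbox.pinW_of_disjoint`); the restriction to the route world is p2-g2's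
`isSubbox_*_graph`. -/

/-- A weighting that agrees with `W` on every pair with an endpoint in `D` has the same subboxes on `D`. [folklore] -/
theorem IsSubbox.congr {G' : SimpleGraph V} [G'.LocallyFinite] {W W' : Sym2 V → unitInterval} {p : unitInterval} {D : Finset V}
    (h : IsSubbox G' W p D) (hW : ∀ x, ∀ v ∈ D, W' s(x, v) = W s(x, v)) : IsSubbox G' W' p D := by
  refine ⟨fun u hu v hv huv => ?_, fun u hu v hv hne huv => ?_, fun v hv hvb x hx => ?_⟩
  · rw [hW u v hv]; exact h.adj u hu v hv huv
  · rw [hW u v hv]; exact h.nadj u hu v hv hne huv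
  · rw [hW x v hv]; exact h.outside v hv hvb x hx

/-- **Pinning pairs inside a set `S` disjoint from `D` keeps `D` a subbox.** [folklore] -/
theorem IsSubbox.pinW_of_disjoint {G' : SimpleGraph V} [G'.LocallyFinite] {W : Sym2 V → unitInterval} {p : unitInterval} {D : Finset V}
    (h : IsSubbox G' W p D) {S : Finset V} (hSD : Disjoint S D) {F₀ : Set (Sym2 V)} (hF₀ : F₀ ⊆ wireSet (↑S : Set V))
    (pat : Set (Sym2 V)) : IsSubbox G' (pinW W F₀ pat) p D := by
  refine h.congr fun x v hv => pinW_apply_of_not_mem W pat fun hx => ?_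
  exact Finset.disjoint_left.1 hSD (Finset.mem_coe.1 (mk_mem_wireSet_iff.1 (hF₀ hx)).2.1) hv

end KNLevels

end Transplant

end Summit.CriticalPhenomena.PercolationContinuityZ3.Theorems

end
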